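import Summits.KontsevichZagierPeriods.KontsevichZagierPeriods.Theorems.RootDecompRelativeModAbsoluteCylLogSplitP44

/-! # `RootDecompRelativeModAbsoluteCylLogSplitP45` — part 20/27 of the mechanical ≤400-line split of `RungClosure.lean` (sha256 f909f334226f0fb5…)
Source: decomp-kz lens-3 g12 `RungClosure.lean` v9 (HOME/decomp-kz-lens-3/g12/, sha256 f909f334…; critic g4-52/g4-57/g5 CLEARED, «lander: split v9 --supports 30572»): BLOCK I (57 g11 monolith decls missing from P01–P25), BLOCK II/III (WildCertAssembly parts 1–6, 8–10: `Leaf.cellLocalWildCert`, `Leaf.cylKernelZeroLog_of_trees`), Parts 12–13 (`Leaf.regKernelPairDegOne_iff_circlePos_of_trees`), BLOCK G13 (Möbius engine, test §C decided).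
Split by census-1 g9 `gen/splitlean.py`: scopes re-opened with their `open`/`variable`/`set_option` context; mathematics and declaration order unchanged. -/

noncomputable section
open Set MeasureTheory Filter Topology
open scoped BigOperators
open Literature.NumberTheory.Transcendental Literature.ModelTheory.ExponentialFields
namespace Summit.KontsevichZagierPeriods.RootDecompRelativeModAbsolute.Rung30571.RegularisedLogLayer.CylLog.Leaf
/-- Auxiliary step `isSemialgebraic_rat_lt`: is Semialgebraic rat lt. [bookkeeping] -/
private theorem isSemialgebraic_rat_lt (r : ℚ) : IsSemialgebraic ℚ {w : Fin 1 → ℝ | (r : ℝ) < w 0} := by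
  simpa using isSemialgebraic_setOf_eval_lt (k := ℚ) (R := ℝ) (ι := Fin 1) (MvPolynomial.C r) (MvPolynomial.X 0)

/-- Auxiliary step `eq_const_fin1`: eq const fin1. [bookkeeping] -/
private theorem eq_const_fin1 (x : Fin 1 → ℝ) : x = fun _ => x 0 :=
  funext fun j => congrArg x (Subsingleton.elim j 0)

section T4geom
variable {q : ℕ}

/-- Ray piece `(r, +∞)`, `r ∈ E` rational (chart `u ↦ r - 1 + u⁻¹` from `(0, 1]`). -/
theorem localWildCert_Ioi {E : Set (Fin 1 → ℝ)} {c κ : Fin q → (Fin 1 → ℝ) → ℝ} {M : Fin q → ℕ}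
    {σ : Fin q → Fin 3} {R : ℕ} {f : Fin R → Fin q → ℤ} {qq : Fin R → (Fin 1 → ℝ) → ℝ}
    (H : CellHyps q E c κ M σ R f qq) {r : ℚ}
    (hPE : {w : Fin 1 → ℝ | (r : ℝ) < w 0} ⊆ E) (hrE : (fun _ : Fin 1 => (r : ℝ)) ∈ E) :
    LocalWildCert {w : Fin 1 → ℝ | (r : ℝ) < w 0} c κ M σ := by
  classical
  have hPsa : IsSemialgebraic ℚ {w : Fin 1 → ℝ | (r : ℝ) < w 0} := isSemialgebraic_rat_lt r
  have hIciE : ∀ t : ℝ, (r : ℝ) ≤ t → (fun _ : Fin 1 => t) ∈ E := by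
    intro t ht
    rcases ht.lt_or_eq with h | h
    · exact hPE (show (fun _ : Fin 1 => t) ∈ {w : Fin 1 → ℝ | (r : ℝ) < w 0} from h)
    · rw [← h]; exact hrE
  have hcontE : ∀ i, ContinuousOn (fun t : ℝ => κ i (fun _ => t)) (Set.Ici (r : ℝ)) := fun i =>
    (H.hκc i).comp (continuous_pi fun _ => continuous_id).continuousOn fun t ht => hIciE t ht
  have hneE : ∀ i, σ i ≠ 2 → ∀ t : ℝ, (r : ℝ) ≤ t → κ i (fun _ => t) ≠ 0 := fun i hi t ht =>
    Tame.ne_zero_of_sigma_ne_two H.hσ0 H.hσ1 i hi _ (hIciE t ht)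
  -- the chart `T u = r - 1 + u⁻¹`, `(0, 1] → [r, +∞)`
  have hT : ∀ u ∈ Set.Ioc (0 : ℝ) 1, (r : ℝ) ≤ (r : ℝ) - 1 + u⁻¹ := by
    intro u hu
    have : 1 ≤ u⁻¹ := (one_le_inv₀ hu.1).2 hu.2
    linarith
  have hTc : ContinuousOn (fun u : ℝ => (r : ℝ) - 1 + u⁻¹) (Set.Ioc (0 : ℝ) 1) :=
    continuousOn_const.add (continuousOn_inv₀.mono fun u hu => ne_of_gt hu.1)
  have hS01 : IsSemialgebraic ℚ {x : Fin 1 → ℝ | x 0 ∈ Set.Ioo (0 : ℝ) 1} := by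
    simpa using isSemialgebraic_Ioo_rat 0 1
  have hφ : ∀ i, IsSemialgebraicFunOn ℚ {x : Fin 1 → ℝ | x 0 ∈ Set.Ioo (0 : ℝ) 1}
      (fun x => κ i (fun _ => (r : ℝ) - 1 + (x 0)⁻¹)) := fun i =>
    CylLogLeaf.isSemialgebraicFunOn_transportInv (φ := fun t => κ i (fun _ => t))
      (((H.hκ i).mono hPE hPsa).congr fun x _ => congrArg (κ i) (eq_const_fin1 x))
  have hcont : ∀ i, ContinuousOn (fun u : ℝ => κ i (fun _ => (r : ℝ) - 1 + u⁻¹)) (Set.Ioc (0 : ℝ) 1) :=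
    fun i => (hcontE i).comp hTc fun u hu => hT u hu
  have hne : ∀ i, σ i ≠ 2 → ∀ u ∈ Set.Ioc (0 : ℝ) 1, κ i (fun _ => (r : ℝ) - 1 + u⁻¹) ≠ 0 :=
    fun i hi u hu => hneE i hi _ (hT u hu)
  obtain ⟨Z, m, δ, Cρ, na, nb, g, h, A, B, β, α, L, hLD, hδ, hCρ, hZσ, hZM, hev⟩ :=
    end_analysis_left (fun i u => κ i (fun _ => (r : ℝ) - 1 + u⁻¹)) M σ one_pos hS01 hφ hcont hne f
  -- back to `+∞`
  have hSt : Tendsto (fun t : ℝ => (t - (r : ℝ) + 1)⁻¹) atTop (𝓝[>] 0) := by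
    refine tendsto_inv_atTop_nhdsGT_zero.comp ?_
    have h := Filter.tendsto_atTop_add_const_right atTop (1 : ℝ)
      (Filter.tendsto_atTop_add_const_right atTop (-(r : ℝ)) tendsto_id)
    simpa only [sub_eq_add_neg, id] using h
  have hev' : ∀ᶠ t in atTop, EndRegime σ M Z m δ Cρ g L (fun i => κ i (fun _ => t)) := by
    refine (hSt.eventually hev).mono fun t ht => ?_
    have e1 : (r : ℝ) - 1 + ((t - (r : ℝ) + 1)⁻¹)⁻¹ = t := by rw [inv_inv]; ring
    simpa only [e1] using ht
  obtain ⟨T₀, hT₀⟩ := eventually_atTop.1 hev'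
  obtain ⟨ρ, hρ⟩ := exists_rat_gt (max T₀ (r : ℝ))
  have hTρ : T₀ < (ρ : ℝ) := (le_max_left _ _).trans_lt hρ
  have hrρ : (r : ℝ) < ρ := (le_max_right _ _).trans_lt hρ
  -- the two pieces `(ρ, +∞)` (wild) and `(r, ρ)` (tame)
  have hPeP : {w : Fin 1 → ℝ | (ρ : ℝ) < w 0} ⊆ {w : Fin 1 → ℝ | (r : ℝ) < w 0} :=
    fun w hw => lt_trans hrρ hw
  have hPrP : {w : Fin 1 → ℝ | w 0 ∈ Set.Ioo (r : ℝ) (ρ : ℝ)} ⊆ {w : Fin 1 → ℝ | (r : ℝ) < w 0} :=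
    fun w hw => hw.1
  have hdisj : Disjoint {w : Fin 1 → ℝ | (ρ : ℝ) < w 0} {w : Fin 1 → ℝ | w 0 ∈ Set.Ioo (r : ℝ) (ρ : ℝ)} :=
    Set.disjoint_left.2 fun w h1 h2 => lt_irrefl _ (lt_trans h1 h2.2)
  have hnull : volume ({w : Fin 1 → ℝ | (r : ℝ) < w 0} \
      ({w : Fin 1 → ℝ | (ρ : ℝ) < w 0} ∪ {w : Fin 1 → ℝ | w 0 ∈ Set.Ioo (r : ℝ) (ρ : ℝ)})) = 0 := by
    refine measure_mono_null (fun w hw => ?_)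
      ((Set.finite_singleton (fun _ : Fin 1 => (ρ : ℝ))).measure_zero volume)
    obtain ⟨hwP, hw⟩ := hw
    rw [Set.mem_union, not_or] at hw
    have h1 : ¬ (ρ : ℝ) < w 0 := fun h => hw.1 h
    have h2 : ¬ w 0 < ρ := fun h => hw.2 ⟨hwP, h⟩
    have h3 : w 0 = ρ := le_antisymm (not_lt.1 h1) (not_lt.1 h2)
    rw [Set.mem_singleton_iff, eq_const_fin1 w, h3]
  have hrest : ∃ δ : ℝ, 0 < δ ∧ ∀ i, σ i ≠ 2 → ∀ x ∈ {w : Fin 1 → ℝ | w 0 ∈ Set.Ioo (r : ℝ) (ρ : ℝ)},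
      δ ≤ |κ i x| := by
    have hK : Set.Icc (r : ℝ) ρ ⊆ Set.Ici (r : ℝ) := fun t ht => ht.1
    obtain ⟨δ', hδ', hP'⟩ := exists_uniform_away (fun i t => κ i (fun _ => t)) σ isCompact_Icc
      (fun i => (hcontE i).mono hK) (fun i hi t ht => hneE i hi t (hK ht))
    refine ⟨δ', hδ', fun i hi x hx => ?_⟩
    have h := hP' i hi (x 0) ⟨hx.1.le, hx.2.le⟩
    rwa [← eq_const_fin1 x] at h
  refine localWildCert_of_split H hPE hPeP hPrP (isOpen_lt continuous_const (continuous_apply 0))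
    (isSemialgebraic_rat_lt ρ) (isOpen_Ioo.preimage (continuous_apply 0)) (isSemialgebraic_Ioo_rat r ρ)
    hdisj hnull hrest ⟨Z, m, δ, Cρ, na, nb, g, h, A, B, β, α, L, hLD, hδ, hCρ, hZσ, hZM, fun x hx => ?_⟩
  have hx' : (ρ : ℝ) < x 0 := hx
  have h := hT₀ (x 0) (lt_trans hTρ hx').le
  rwa [← eq_const_fin1 x] at h

/-! ### 10f. The assembly -/

/-- **T4 (g12).**  The residual `CellLocalWildCert` of the rung `CylKernelZeroLog` holds. -/
theorem cellLocalWildCert : CellLocalWildCert := by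
  intro E V a₀ q c κ M σ R f qq hEo hE _ _ _ hc _ hκ hκs hκ1 hσ0 hσ1 hσ2 _ hL1 _ _ _ hqq hprod hcoef
  have H : CellHyps q E c κ M σ R f qq :=
    ⟨hEo, hE, hc, hκ, fun i => (hκs i).continuousOn, hκ1, hσ0, hσ1, hσ2, hL1, hqq, hprod, hcoef⟩
  obtain ⟨n, r, hrE, -, -, hsub, hdisj, hnull⟩ := CylLogLeaf.exists_oneEnded_pieces_of_isSemialgebraic hEo hE
  refine localWildCert_of_pieces hsub hdisj hnull fun p => ?_
  obtain ⟨j, b⟩ := p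
  cases b with
  | false =>
    show LocalWildCert (CylLogLeaf.segBelow E (r j)) c κ M σ
    have hPsa := CylLogLeaf.isSemialgebraic_segBelow hE (r j)
    have hPE := CylLogLeaf.segBelow_subset E (r j)
    rcases CylLogLeaf.segBelow_eq_Ioo_or_Iio hEo (hrE j) with ⟨e, her, hPeq, -⟩ | hPeq
    · rw [hPeq] at hPsa hPE ⊢
      exact localWildCert_Ioo_left H her hPsa hPE (hrE j)
    · rw [hPeq] at hPE ⊢
      exact localWildCert_Iio H hPE (hrE j)
  | true =>
    show LocalWildCert (CylLogLeaf.segAbove E (r j)) c κ M σ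
    have hPsa := CylLogLeaf.isSemialgebraic_segAbove hE (r j)
    have hPE := CylLogLeaf.segAbove_subset E (r j)
    rcases CylLogLeaf.segAbove_eq_Ioo_or_Ioi hEo (hrE j) with ⟨e, hre, hPeq, -⟩ | hPeq
    · rw [hPeq] at hPsa hPE ⊢
      exact localWildCert_Ioo_right H hre hPsa hPE (hrE j)
    · rw [hPeq] at hPE ⊢
      exact localWildCert_Ioi H hPE (hrE j)

end T4geom

/-! ### 10g. The rung `CylKernelZeroLog`, modulo the two TREE theorems only (v4) -/

/-- **Corollary (g12, v4).**  The rung `CylKernelZeroLog` (log kind of the one-cylinder kernel statement ⟺ item 30572)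
follows from the tree's structure theorem `LogStructure` and boundary rigidity `BoundaryRigidity` ALONE: the third
hypothesis `CellLocalWildCert` of the g11 glue `cylKernelZeroLog_of_localWildCert` (landed, `…CylLogSplitP24`) is the
theorem `cellLocalWildCert` above. -/
theorem cylKernelZeroLog_of_trees (hLS : LogStructure)
    (hBR : Summit.KontsevichZagierPeriods.LiouvilleUnfolding.LogPrimitiveNL.Negative.BoundaryRigidity) :
    CylKernelZeroLog :=
  cylKernelZeroLog_of_localWildCert hLS hBR cellLocalWildCert

/-! ### Item-level corollaries (g12): where item 30572 `RegKernelPairDegOne` stands after this file.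
`RegKernelPairDegOne ⟺ CylKernelZero` (g9 EQUIV, landed `regKernelPairDegOne_iff_cylKernelZero`, P2) and
`CylKernelZero ⟺ CylKernelZeroLog ∧ CylKernelZeroMixed` (kind split, BLOCK I-A); the log kind is closed above modulo
the two tree theorems, so the ITEM is reduced to the tree theorems and the ONE residual `CylKernelZeroMixed`
(arctangent kind; tagged WEAKER than `CylKernelZero` — its `∃ i, eᵢ = 2` specialisation; UNDECIDED; leaf IDEA-NEEDED:
circle structure theorem + circle boundary rigidity, NODE-g11.md §M / NODE-g12.md). -/

/-- **Rung + mixed kind ⟹ `CylKernelZero`.** -/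
theorem cylKernelZero_of_trees_and_mixed (hLS : LogStructure)
    (hBR : Summit.KontsevichZagierPeriods.LiouvilleUnfolding.LogPrimitiveNL.Negative.BoundaryRigidity)
    (hM : CylKernelZeroMixed) : CylKernelZero :=
  cylKernelZero_of_log_and_mixed (cylKernelZeroLog_of_trees hLS hBR) hM

/-- **The ITEM decl of route C″** `Theses.RootDecompRelativeModAbsolute.RegKernelPairDegOne` (stmt-30572) from the two
tree theorems and the single residual `CylKernelZeroMixed`, through the landed certified translation. -/
theorem regKernelPairDegOne_of_trees_and_mixed (hLS : LogStructure)
    (hBR : Summit.KontsevichZagierPeriods.LiouvilleUnfolding.LogPrimitiveNL.Negative.BoundaryRigidity)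
    (hM : CylKernelZeroMixed) :
    Summit.KontsevichZagierPeriods.KontsevichZagierPeriods.Theses.RootDecompRelativeModAbsolute.RegKernelPairDegOne :=
  regKernelPairDegOne_iff_cylKernelZero.mpr (cylKernelZero_of_trees_and_mixed hLS hBR hM)

/-- Conversely the residual is NECESSARY: the item implies `CylKernelZeroMixed` (so the reduction loses nothing). -/
theorem cylKernelZeroMixed_of_regKernelPairDegOne
    (h : Summit.KontsevichZagierPeriods.KontsevichZagierPeriods.Theses.RootDecompRelativeModAbsolute.RegKernelPairDegOne) :
    CylKernelZeroMixed :=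
  cylKernelZeroMixed_of_cylKernelZero (regKernelPairDegOne_iff_cylKernelZero.mp h)

/-! ### Part 12 (g12) — the sign dichotomy of the arctangent kind: `κ ≤ 0` arctangent terms are LOG KIND

For an arctangent-kind term (`eᵢ = 2`) with `κᵢ ≤ 0` put `λᵢ = √(−κᵢ)` (`ℚ`-semialgebraic, `0 ≤ λᵢ < 1`); then
`θ^M/(1+θ²κᵢ) = θ^M/(1−θ²λᵢ²) = ½·θ^M/(1+θ·(−λᵢ)) + ½·θ^M/(1+θ·λᵢ)` is the sum of two LOG-kind kernels with
`κ = ∓λᵢ > −1`.  Hence `CylKernelZeroMixed` restricted to families all of whose arctangent-kind terms have `κᵢ ≤ 0`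
on `P` (`CylKernelZeroMixedNonpos`) follows from `CylKernelZeroLog` (reindex over `Fin (q + q)`), and
`CylKernelZeroMixed ⟺ CylKernelZeroMixedNonpos ∧ CylKernelZeroMixedPos` where the residual `CylKernelZeroMixedPos`
keeps only the families with an arctangent-kind term that is POSITIVE SOMEWHERE on `P` (the genuinely circular
kind `arctan(θ√κ)/√κ`). -/

/-- **`CylKernelZeroMixedNonpos`** — `CylKernelZeroMixed` for families whose arctangent-kind terms all have `κᵢ ≤ 0`
on `P`.  [tag: WEAKER than `CylKernelZeroMixed` (a specialisation); PROVED from `CylKernelZeroLog`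
(`cylKernelZeroMixedNonpos_of_log`, partial fractions), hence closed modulo the two tree theorems] -/
def CylKernelZeroMixedNonpos : Prop :=
  ∀ (P : Set (Fin 1 → ℝ)) (V : KZ.IntegralRep (1 + 1)) (a₀ : (Fin 1 → ℝ) → ℝ) (q : ℕ)
    (c κ : Fin q → (Fin 1 → ℝ) → ℝ) (M e : Fin q → ℕ),
    IsSemialgebraic ℚ P → IsSemialgebraicFunOn ℚ P a₀ → IntegrableOn a₀ P →
    (∀ i, IsSemialgebraicFunOn ℚ P (c i)) → (∀ i, IsSemialgebraicFunOn ℚ P (κ i)) →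
    (∀ i, e i = 1 ∨ e i = 2) → (∃ i, e i = 2) → (∀ i, ∀ x ∈ P, -1 < κ i x) →
    (∀ i, e i = 2 → ∀ x ∈ P, κ i x ≤ 0) →
    (∀ i, IntegrableOn (fun z : Fin (1 + 1) → ℝ =>
      c i (Fin.init z) * (z (Fin.last 1) ^ M i / (1 + z (Fin.last 1) ^ e i * κ i (Fin.init z))))
      {z : Fin (1 + 1) → ℝ | (Fin.init z : Fin 1 → ℝ) ∈ P ∧ z (Fin.last 1) ∈ Set.Ioo 0 1}) →
    (∀ i, IntegrableOn (fun x => c i x * ∫ θ in Set.Ioo (0 : ℝ) 1, θ ^ M i / (1 + θ ^ e i * κ i x)) P) →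
    V.domain = {z : Fin (1 + 1) → ℝ | (Fin.init z : Fin 1 → ℝ) ∈ P ∧ z (Fin.last 1) ∈ Set.Ioo 0 1} →
    Set.EqOn V.integrand (fun z => a₀ (Fin.init z) +
      ∑ i, c i (Fin.init z) * (z (Fin.last 1) ^ M i / (1 + z (Fin.last 1) ^ e i * κ i (Fin.init z))))
      V.domain →
    (∀ᵐ x : (Fin 1 → ℝ), x ∈ P →
      a₀ x + ∑ i, c i x * ∫ θ in Set.Ioo (0 : ℝ) 1, θ ^ M i / (1 + θ ^ e i * κ i x) = 0) →
    KZ.of V ∈ KZ.relations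

/-- **`CylKernelZeroMixedPos`** — THE RESIDUAL of the arctangent kind after Part 12: `CylKernelZeroMixed` for families
with an arctangent-kind term `eᵢ = 2` that is POSITIVE SOMEWHERE on `P` (`∃ i x, eᵢ = 2 ∧ x ∈ P ∧ 0 < κᵢ x`).
[tag: WEAKER than `CylKernelZeroMixed` (a specialisation, `cylKernelZeroMixedPos_of_mixed`), hence WEAKER than
`CylKernelZero`, the item and the summit; with `CylKernelZeroMixedNonpos` EQUIVALENT to `CylKernelZeroMixed`
(`cylKernelZeroMixed_iff_nonpos_and_pos`, a case split); UNDECIDED; leaf IDEA-NEEDED (joint log/circle Ax–Schanuel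
structure cells + circle boundary rigidity by the Möbius rotation `t ↦ (t + b)/(1 − t b)`, NODE-g12.md)] -/
def CylKernelZeroMixedPos : Prop :=
  ∀ (P : Set (Fin 1 → ℝ)) (V : KZ.IntegralRep (1 + 1)) (a₀ : (Fin 1 → ℝ) → ℝ) (q : ℕ)
    (c κ : Fin q → (Fin 1 → ℝ) → ℝ) (M e : Fin q → ℕ),
    IsSemialgebraic ℚ P → IsSemialgebraicFunOn ℚ P a₀ → IntegrableOn a₀ P →
    (∀ i, IsSemialgebraicFunOn ℚ P (c i)) → (∀ i, IsSemialgebraicFunOn ℚ P (κ i)) →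
    (∀ i, e i = 1 ∨ e i = 2) → (∃ i, e i = 2) → (∀ i, ∀ x ∈ P, -1 < κ i x) →
    (∃ i, e i = 2 ∧ ∃ x ∈ P, 0 < κ i x) →
    (∀ i, IntegrableOn (fun z : Fin (1 + 1) → ℝ =>
      c i (Fin.init z) * (z (Fin.last 1) ^ M i / (1 + z (Fin.last 1) ^ e i * κ i (Fin.init z))))
      {z : Fin (1 + 1) → ℝ | (Fin.init z : Fin 1 → ℝ) ∈ P ∧ z (Fin.last 1) ∈ Set.Ioo 0 1}) →
    (∀ i, IntegrableOn (fun x => c i x * ∫ θ in Set.Ioo (0 : ℝ) 1, θ ^ M i / (1 + θ ^ e i * κ i x)) P) →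
    V.domain = {z : Fin (1 + 1) → ℝ | (Fin.init z : Fin 1 → ℝ) ∈ P ∧ z (Fin.last 1) ∈ Set.Ioo 0 1} →
    Set.EqOn V.integrand (fun z => a₀ (Fin.init z) +
      ∑ i, c i (Fin.init z) * (z (Fin.last 1) ^ M i / (1 + z (Fin.last 1) ^ e i * κ i (Fin.init z))))
      V.domain →
    (∀ᵐ x : (Fin 1 → ℝ), x ∈ P →
      a₀ x + ∑ i, c i x * ∫ θ in Set.Ioo (0 : ℝ) 1, θ ^ M i / (1 + θ ^ e i * κ i x) = 0) →
    KZ.of V ∈ KZ.relations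

/-- Edge (PROVED): `CylKernelZeroMixed ⟹ CylKernelZeroMixedPos` — drop the extra hypothesis. -/
theorem cylKernelZeroMixedPos_of_mixed (h : CylKernelZeroMixed) : CylKernelZeroMixedPos := by
  intro P V a₀ q c κ M e hP ha₀ ha₀i hc hκ he h2 hκ1 _ hint hL1 hdom hV hae
  exact h P V a₀ q c κ M e hP ha₀ ha₀i hc hκ he h2 hκ1 hint hL1 hdom hV hae

/-- Edge (PROVED): `CylKernelZeroMixed ⟹ CylKernelZeroMixedNonpos`. -/
theorem cylKernelZeroMixedNonpos_of_mixed (h : CylKernelZeroMixed) : CylKernelZeroMixedNonpos := by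
  intro P V a₀ q c κ M e hP ha₀ ha₀i hc hκ he h2 hκ1 _ hint hL1 hdom hV hae
  exact h P V a₀ q c κ M e hP ha₀ ha₀i hc hκ he h2 hκ1 hint hL1 hdom hV hae

/-- **Assembly of the sign dichotomy (PROVED):** `CylKernelZeroMixedNonpos ∧ CylKernelZeroMixedPos ⟹ CylKernelZeroMixed`
(case split on «some arctangent-kind `κᵢ` is positive somewhere on `P`»). -/
theorem cylKernelZeroMixed_of_nonpos_and_pos (hN : CylKernelZeroMixedNonpos) (hPo : CylKernelZeroMixedPos) :
    CylKernelZeroMixed := by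
  intro P V a₀ q c κ M e hP ha₀ ha₀i hc hκ he h2 hκ1 hint hL1 hdom hV hae
  by_cases hpos : ∃ i, e i = 2 ∧ ∃ x ∈ P, 0 < κ i x
  · exact hPo P V a₀ q c κ M e hP ha₀ ha₀i hc hκ he h2 hκ1 hpos hint hL1 hdom hV hae
  · have hnp : ∀ i, e i = 2 → ∀ x ∈ P, κ i x ≤ 0 := by
      intro i hi x hx
      by_contra hlt
      exact hpos ⟨i, hi, x, hx, lt_of_not_ge hlt⟩
    exact hN P V a₀ q c κ M e hP ha₀ ha₀i hc hκ he h2 hκ1 hnp hint hL1 hdom hV hae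

/-- Auxiliary step `cylKernelZeroMixed_iff_nonpos_and_pos`: cyl Kernel Zero Mixed iff nonpos and pos. [bookkeeping] -/
theorem cylKernelZeroMixed_iff_nonpos_and_pos :
    CylKernelZeroMixed ↔ CylKernelZeroMixedNonpos ∧ CylKernelZeroMixedPos :=
  ⟨fun h => ⟨cylKernelZeroMixedNonpos_of_mixed h, cylKernelZeroMixedPos_of_mixed h⟩,
    fun h => cylKernelZeroMixed_of_nonpos_and_pos h.1 h.2⟩

/-! #### Measure-theoretic and one-variable lemmas for the partial-fraction reindexing -/

/-- The log-kind fibre integral `x ↦ ∫₀¹ θ^M/(1+θ·g x) dθ` is a.e. strongly measurable on a measurable base over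
which `g` is a.e. measurable (Fubini measurability of a parametric integral, after replacing `g` by a measurable
modification). [folklore] -/
theorem aestronglyMeasurable_fibreLog {P : Set (Fin 1 → ℝ)} {g : (Fin 1 → ℝ) → ℝ}
    (hg : AEMeasurable g (volume.restrict P)) (M : ℕ) :
    AEStronglyMeasurable (fun x => ∫ θ in Ioo (0:ℝ) 1, θ ^ M / (1 + θ * g x)) (volume.restrict P) := by
  set g' := hg.mk g with hg'def
  have hg'm : Measurable g' := hg.measurable_mk
  have hgg' : g =ᵐ[volume.restrict P] g' := hg.ae_eq_mk
  -- the jointly measurable integrand on the product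
  set Φ : (Fin 1 → ℝ) × ℝ → ℝ :=
    (Set.univ ×ˢ Ioo (0:ℝ) 1).indicator (fun p => p.2 ^ M / (1 + p.2 * g' p.1)) with hΦ
  have hFm : Measurable (fun p : (Fin 1 → ℝ) × ℝ => p.2 ^ M / (1 + p.2 * g' p.1)) :=
    (measurable_snd.pow_const M).div (measurable_const.add (measurable_snd.mul (hg'm.comp measurable_fst)))
  have hΦm : Measurable Φ := hFm.indicator (MeasurableSet.univ.prod measurableSet_Ioo)
  have hI : StronglyMeasurable fun x : Fin 1 → ℝ => ∫ y, Φ (x, y) :=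
    hΦm.stronglyMeasurable.integral_prod_right'
  have hIeq : (fun x : Fin 1 → ℝ => ∫ y, Φ (x, y)) = fun x => ∫ θ in Ioo (0:ℝ) 1, θ ^ M / (1 + θ * g' x) := by
    funext x
    have : (fun y => Φ (x, y)) = (Ioo (0:ℝ) 1).indicator (fun θ => θ ^ M / (1 + θ * g' x)) := by
      funext y
      simp only [hΦ, Set.indicator_apply, Set.mem_prod, Set.mem_univ, true_and]
    rw [this, integral_indicator measurableSet_Ioo]
  rw [hIeq] at hI
  refine hI.aestronglyMeasurable.congr ?_
  filter_upwards [hgg'] with x hx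
  simp only [hx]

/-- On `[0,1]`, for `0 ≤ λ < 1`: the log-kind kernels `θ^M/(1 ∓ θλ)` and the circle-kind kernel `θ^M/(1 − θ²λ²)` are
continuous, hence integrable on `(0,1)`. -/
theorem integrableOn_kernel_lin (M : ℕ) {s : ℝ} (hs : -1 < s) :
    IntegrableOn (fun θ : ℝ => θ ^ M / (1 + θ * s)) (Ioo (0:ℝ) 1) := by
  have hcont : ContinuousOn (fun θ : ℝ => θ ^ M / (1 + θ * s)) (Icc (0:ℝ) 1) := by
    refine ContinuousOn.div (by fun_prop) (by fun_prop) fun θ hθ => ?_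
    have h0 : 0 ≤ θ := hθ.1
    have h1 : θ ≤ 1 := hθ.2
    refine (show (0:ℝ) < 1 + θ * s from ?_).ne'
    rcases le_or_gt 0 s with hs0 | hs0
    · nlinarith [mul_nonneg h0 hs0]
    · nlinarith [mul_le_mul_of_nonpos_right h1 hs0.le]
  exact (hcont.integrableOn_Icc).mono_set Ioo_subset_Icc_self

/-- Auxiliary step `integrableOn_kernel_sq`: integrable On kernel sq. [bookkeeping] -/
theorem integrableOn_kernel_sq (M : ℕ) {l : ℝ} (hl0 : 0 ≤ l) (hl1 : l < 1) :
    IntegrableOn (fun θ : ℝ => θ ^ M / (1 - θ ^ 2 * l ^ 2)) (Ioo (0:ℝ) 1) := by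
  have hcont : ContinuousOn (fun θ : ℝ => θ ^ M / (1 - θ ^ 2 * l ^ 2)) (Icc (0:ℝ) 1) := by
    refine ContinuousOn.div (by fun_prop) (by fun_prop) fun θ hθ => ?_
    have h0 : 0 ≤ θ := hθ.1
    have h1 : θ ≤ 1 := hθ.2
    have : θ ^ 2 * l ^ 2 < 1 := by
      have hθ2 : θ ^ 2 ≤ 1 := by nlinarith
      have hl2 : l ^ 2 < 1 := by nlinarith
      nlinarith [sq_nonneg θ, sq_nonneg l]
    linarith
  exact (hcont.integrableOn_Icc).mono_set Ioo_subset_Icc_self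

/-- The partial-fraction identity `½/(1−a) + ½/(1+a) = 1/(1−a²)` in the form used (`a = θλ`). -/
theorem half_kernel_add (M : ℕ) {θ l : ℝ} (h1 : 1 - θ * l ≠ 0) (h2 : 1 + θ * l ≠ 0) :
    (1/2 : ℝ) * (θ ^ M / (1 + θ * -l)) + (1/2 : ℝ) * (θ ^ M / (1 + θ * l)) = θ ^ M / (1 - θ ^ 2 * l ^ 2) := by
  have h3 : 1 - θ ^ 2 * l ^ 2 ≠ 0 := by
    have : 1 - θ ^ 2 * l ^ 2 = (1 - θ * l) * (1 + θ * l) := by ring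
    rw [this]; exact mul_ne_zero h1 h2
  have e1 : 1 + θ * -l = 1 - θ * l := by ring
  rw [e1, mul_div_assoc', mul_div_assoc', div_add_div _ _ h1 h2, div_eq_div_iff (mul_ne_zero h1 h2) h3]
  ring

end Summit.KontsevichZagierPeriods.RootDecompRelativeModAbsolute.Rung30571.RegularisedLogLayer.CylLog.Leaf
end
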